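import Summits.BirchSwinnertonDyer.BirchSwinnertonDyer.Theorems.AdditiveKolyvaginRoadAdmissibleRaiseFree
import Summits.BirchSwinnertonDyer.BirchSwinnertonDyer.Theorems.AdditiveKolyvaginRoadLevelSystemsCoreConnected
import HarnessLib

/-!
# Route `AdditiveKolyvaginRoad`, crux `LevelKolyvaginSystemsAdditive` (item stmt-BirchSwinnertonDyer-21396, KS′):
# Howard's core graph of the carrier CONNECTED, and KS′'s conclusion from a bipartite datum + ONE seed, modulo the
# Poitou–Tate fact and odd bottom rank — the (R′) binder of width seat w2 g2's part 5 DISCHARGED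
# (cell `pub/bsd-wall`, width seat `bsd-wall-akr-p2x-w3` g3; `--supports stmt-BirchSwinnertonDyer-21396`, helper)

WHAT. w2 g2's `…LevelSystemsCoreConnected` (p590970) proved `selQP_coreConnected` (Howard 2006 Prop. 2.4.11 for the
canonical spaces `SelQP` in `H¹(K, E[p])`) and `nonempty_levelKolyvaginSystemP_of_bipartite_of_seed_at_frame` GIVEN the binder
(R′) `hraise` = witness-free one-prime raising. `…AdmissibleRaiseFree` (this seat) proved (R′) as `selQP_raise_of_admQ_of_sign`
modulo `poitouTate_selmerStructure_duality K`. This file plugs one into the other: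
* `selQP_raise_free` — (R′) in the exact shape of `hraise` (inclusion `Sel_m^μ ≤ Sel_{m∪q}^μ` by akr-p2x g0's «in»
  `mem_selQP_insert_of_forall_mem_torsionLocalKer`; the count at the place `(q)` of `K` above the inert `q`);
* `selQP_coreConnected_of_poitouTate` — THE CARRIER'S CORE GRAPH IS CONNECTED at a ♯ additive frame modulo the PT fact and
  odd `dim Sel_∅⁺ + dim Sel_∅⁻`;
* `nonempty_levelKolyvaginSystemP_of_bipartite_of_seed_of_poitouTate` — KS′'s conclusion `Nonempty (LevelKolyvaginSystemP …)`
  at a ♯ frame from a BIPARTITE datum (two-sided laws), `selmer_bottom`, ONE SEED at a core level, the PT fact and odd bottom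
  rank. KERNEL READING: under the KS′ socket «bipartite datum + one seed» the E-side residual is now ONLY the named fact
  `poitouTate_selmerStructure_duality K` (the route's DUAL input) and the parity of `dim_{𝔽_p} Sel_p(E/K)` (odd at `r_an = 1`
  frames by akr-p1's `oddSelmerRankAdditive_of_published` modulo PUB, after conversion to `SelQP ∅`). The crux's open content
  (K1 classes at `p²`-level, multiplicity one in the laws, the seed) is untouched.
* companion `…LevelSystemsOfSeedPublishedFree` (separate file, inside the route file's import cone): w2 g2's part 6
  `…_of_seed_of_published` with (R′) discharged by the Poitou–Tate conjunct of `PublishedDualityInputsAdditiveKoly` — KS′'s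
  conclusion at a ♯ frame ⟸ PUB ∧ DUAL ∧ bipartite datum ∧ `selmer_bottom` ∧ ONE seed, NO E-side binder left.

HONEST FRAMING: theorems only; 0 definitions, 0 named facts, 0 `sorry`; CONDITIONAL (PT fact, odd bottom rank, the bipartite
datum, the laws and the seed are HYPOTHESES); closes nothing. BSD is not proved by any of this.

References: [cite: Howard2006Bipartite, Lemma 2.4.10, Prop. 2.4.11, Thm. 2.5.1] [cite: WZhang2014, Thm. 4.3, (4.8), Lemma 5.3,
Prop. 5.4, Thm. 7.2, Lemma 7.3, §9] [cite: BertoliniDarmon2005, Thm. 3.2, Thm. 4.1, Thm. 4.2].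
-/

-- single-conjunct summit: `Summit.BirchSwinnertonDyer.BirchSwinnertonDyer.…` repeats the name by design
set_option linter.dupNamespace false

noncomputable section

open scoped Classical

namespace Summit.BirchSwinnertonDyer.BirchSwinnertonDyer.Theorems.AdditiveKoly

open WeierstrassCurve NumberField IsDedekindDomain
  Literature.NumberTheory.EllipticCurves Literature.NumberTheory.EllipticCurves.ModularForms
  Literature.NumberTheory.EllipticCurves.Rank1Residual Literature.NumberTheory.GaloisRepresentations Module
  Literature.NumberTheory.GaloisCohomology Summit.BirchSwinnertonDyer.Rank1Residual.X11b.Three.Koly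

variable (W : WeierstrassCurve ℚ) (K : Type) [Field K] [NumberField K] (p : ℕ) [W.IsElliptic] [W.IsGloballyMinimal]
  [Fact p.Prime] [Module (ZMod p) (Vp W K p)]

/-! ## §1 (R′) in the `hraise` binder shape of `selQP_coreConnected` -/

/-- **(R′) in the binder shape `hraise` of `selQP_coreConnected`** (width seat w2 g2's `…LevelSystemsCoreConnected`, Howard's
core graph connected at a ♯ frame): for `q ∉ m` admissible of sign `μ`, if every class of `Sel_m^μ` is locally trivial above
`q` then `Sel_m^μ ≤ Sel_{m∪q}^μ` (akr-p2x g0's «in» `mem_selQP_insert_of_forall_mem_torsionLocalKer`) and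
`dim Sel_{m∪q}^μ = dim Sel_m^μ + 1` (`selQP_raise_of_admQ_of_sign` at the place `(q)` of `K` above the inert `q`). Modulo
`poitouTate_selmerStructure_duality K` only. [cite: WZhang2014, Lemma 5.3, Prop. 5.4] [cite: Howard2006Bipartite, Prop. 2.4.11] -/
theorem selQP_raise_free (hK : IsImaginaryQuadratic K) (hp2 : p ≠ 2) (c : K ≃ₐ[ℚ] K)
    (hPT : poitouTate_selmerStructure_duality K) :
    ∀ (m : Finset (AdmQ W K p)) (q : AdmQ W K p) (μ : Bool), q ∉ m →
      (∀ v : HeightOneSpectrum (𝓞 K), ((q : ℕ) : 𝓞 K) ∈ v.asIdeal → ∀ z : Vp W K p,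
        (W.baseChange K).torsionLocMap (v.adicCompletion K) ((p ^ 1 : ℕ) : ℤ) (conjAct W c ((p ^ 1 : ℕ) : ℤ) z) =
          sgnP μ • (W.baseChange K).torsionLocMap (v.adicCompletion K) ((p ^ 1 : ℕ) : ℤ) z) →
      (∀ x ∈ SelQP W K p c m μ, ∀ v : HeightOneSpectrum (𝓞 K), ((q : ℕ) : 𝓞 K) ∈ v.asIdeal →
        x ∈ (W.baseChange K).torsionLocalKer (v.adicCompletion K) ((p ^ 1 : ℕ) : ℤ)) →
      SelQP W K p c m μ ≤ SelQP W K p c (insert q m) μ ∧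
        finrank (ZMod p) (SelQP W K p c (insert q m) μ) = finrank (ZMod p) (SelQP W K p c m μ) + 1 := by
  intro m q μ hqm hε hT
  -- the place of `K` above the inert admissible `q`
  have hqP : (Ideal.span {((q : ℕ) : 𝓞 K)}).IsPrime := q.2.2.2.1
  have hqbot : Ideal.span {((q : ℕ) : 𝓞 K)} ≠ ⊥ := by
    rw [Ne, Ideal.span_singleton_eq_bot]; exact_mod_cast q.2.1.ne_zero
  set v₀ : HeightOneSpectrum (𝓞 K) := ⟨Ideal.span {((q : ℕ) : 𝓞 K)}, hqP, hqbot⟩ with hv₀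
  have hqv₀ : ((q : ℕ) : 𝓞 K) ∈ v₀.asIdeal := Ideal.subset_span rfl
  exact ⟨fun y hy ↦ mem_selQP_insert_of_forall_mem_torsionLocalKer W K p c hqm hy (hT y hy),
    selQP_raise_of_admQ_of_sign W K p hK hp2 hPT m q μ v₀ hqm hqv₀ (hε v₀ hqv₀) (fun y hy ↦ hT y hy v₀ hqv₀)⟩

/-! ## §2 The carrier's core graph connected, and KS′'s conclusion from a bipartite datum + one seed, modulo Poitou–Tate -/

/-- **THE CARRIER'S CORE GRAPH IS CONNECTED at a ♯ additive frame, modulo the Poitou–Tate fact and ODD bottom rank** — w2 g2's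
`selQP_coreConnected` with its (R′) binder `hraise` DISCHARGED by `selQP_raise_free`: at `p ≥ 5` additive with `ρ̄_{E,p}` onto,
`K` imaginary quadratic Heegner for `N_E`, `c ≠ 1`, `poitouTate_selmerStructure_duality K` and `dim Sel_∅⁺ + dim Sel_∅⁻` odd, every
non-empty even level of canonical rank one is joined to any level of total rank `≤ 1` through core edges (Howard 2006 Prop. 2.4.11
for the canonical spaces `SelQP` in `H¹(K, E[p])`). CONDITIONAL on the named PT fact; closes nothing.
[cite: Howard2006Bipartite, Prop. 2.4.11, Thm. 2.5.1] [cite: WZhang2014, Lemma 5.3, Prop. 5.4, Lemma 7.3] -/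
theorem selQP_coreConnected_of_poitouTate (h5 : 5 ≤ p) (hadd : Addv W p) (hsurj : W.HasSurjectiveModNGaloisRep p)
    (hK : IsImaginaryQuadratic K) (hH : SatisfiesHeegnerHypothesis (W.conductorNorm ℤ) K) (c : K ≃ₐ[ℚ] K) (hc1 : c ≠ 1)
    (hPT : poitouTate_selmerStructure_duality K)
    (hodd : Odd (finrank (ZMod p) (SelQP W K p c ∅ true) + finrank (ZMod p) (SelQP W K p c ∅ false)))
    {n₀ : Finset (AdmQ W K p)}
    (hn₀ : finrank (ZMod p) (SelQP W K p c n₀ true) + finrank (ZMod p) (SelQP W K p c n₀ false) ≤ 1) :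
    ∀ n : Finset (AdmQ W K p), n.Nonempty → Even n.card →
      finrank (ZMod p) (SelQP W K p c n true) + finrank (ZMod p) (SelQP W K p c n false) = 1 →
      Relation.EqvGen (fun a b : Finset (AdmQ W K p) ↦ ∃ q, q ∉ a ∧ b = insert q a ∧
        (Even a.card → SelQP W K p c (insert q a) true = ⊥ ∧ SelQP W K p c (insert q a) false = ⊥) ∧
        (Odd a.card → SelQP W K p c a true = ⊥ ∧ SelQP W K p c a false = ⊥)) n₀ n :=
  selQP_coreConnected W K p c h5 hadd hsurj hK hH hc1 (selQP_raise_free W K p hK (by omega) c hPT) hodd hn₀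

variable (c : K ≃ₐ[ℚ] K) [NeZero (W.conductorNorm ℤ)] (Dt : ModularParametrizationData W (W.conductorNorm ℤ)) (β : ℤ)
  (ι : K →+* ℂ)

/-- **KS′'s conclusion at a ♯ additive frame from a BIPARTITE datum, ONE SEED at a core level, the Poitou–Tate fact and ODD
bottom rank** — w2 g2's `nonempty_levelKolyvaginSystemP_of_bipartite_of_seed_at_frame` with its (R′) binder `hraise` DISCHARGED
by `selQP_raise_free`. Binders: the bipartite datum (`ε₀, κ₀, lam`, realisation at level `∅`, local axioms and the relation (8.1)
at non-empty even levels, the laws (A), (B) two-sided), `selmer_bottom`, a level `n₀` of total rank `≤ 1` carrying the SEED (a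
non-zero conductor-one class if `#n₀` is even, a unit value if odd), `poitouTate_selmerStructure_duality K`, odd
`dim Sel_∅⁺ + dim Sel_∅⁻`. CONDITIONAL; closes nothing; BSD is not proved by this. [cite: Howard2006Bipartite, Prop. 2.4.11,
Thm. 2.5.1] [cite: WZhang2014, Thm. 4.3, Lemma 5.3, Prop. 5.4, Thm. 7.2, §9] [cite: BertoliniDarmon2005, Thm. 4.1, Thm. 4.2] -/
theorem nonempty_levelKolyvaginSystemP_of_bipartite_of_seed_of_poitouTate (h5 : 5 ≤ p) (hadd : Addv W p)
    (hsurj : W.HasSurjectiveModNGaloisRep p) (hK : IsImaginaryQuadratic K)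
    (hH : SatisfiesHeegnerHypothesis (W.conductorNorm ℤ) K) (hc1 : c ≠ 1)
    (ε₀ : Finset (AdmQ W K p) → Bool)
    (κ₀ : Finset {ℓ // Zhang2014.IsKolyvaginPrime (W.conductorNorm ℤ) W K p ℓ} → Finset (AdmQ W K p) → Vp W K p)
    (lam : Finset {ℓ // Zhang2014.IsKolyvaginPrime (W.conductorNorm ℤ) W K p ℓ} → Finset (AdmQ W K p) → ZMod p)
    (realisation : ∀ m : Finset {ℓ // Zhang2014.IsKolyvaginPrime (W.conductorNorm ℤ) W K p ℓ},
      ∃ d : KolyvaginHeegnerData Dt β ι (∏ ℓ ∈ m, (ℓ : ℕ)), κ₀ m ∅ = d.kolyvaginClass (Fact.out : p.Prime) 1)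
    (sign : ∀ n : Finset (AdmQ W K p), n.Nonempty → Even n.card →
      ∀ m : Finset {ℓ // Zhang2014.IsKolyvaginPrime (W.conductorNorm ℤ) W K p ℓ},
      conjAct W c ((p ^ 1 : ℕ) : ℤ) (κ₀ m n) = sgnP (ε₀ n ^^ Nat.bodd m.card) • κ₀ m n)
    (selmer_off : ∀ n : Finset (AdmQ W K p), n.Nonempty → Even n.card →
      ∀ (m : Finset {ℓ // Zhang2014.IsKolyvaginPrime (W.conductorNorm ℤ) W K p ℓ}) (v : HeightOneSpectrum (𝓞 K)),
      (∀ ℓ ∈ m, ((ℓ : ℕ) : 𝓞 K) ∉ v.asIdeal) → (∀ q ∈ n, ((q : ℕ) : 𝓞 K) ∉ v.asIdeal) →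
      κ₀ m n ∈ selmerLocalKer (W.baseChange K) (v.adicCompletion K) ((p ^ 1 : ℕ) : ℤ))
    (selmer_inf : ∀ n : Finset (AdmQ W K p), n.Nonempty → Even n.card →
      ∀ (m : Finset {ℓ // Zhang2014.IsKolyvaginPrime (W.conductorNorm ℤ) W K p ℓ}) (w : InfinitePlace K),
      κ₀ m n ∈ selmerLocalKer (W.baseChange K) w.Completion ((p ^ 1 : ℕ) : ℤ))
    (toric_on : ∀ n : Finset (AdmQ W K p), n.Nonempty → Even n.card →
      ∀ m : Finset {ℓ // Zhang2014.IsKolyvaginPrime (W.conductorNorm ℤ) W K p ℓ}, ∀ q ∈ n,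
      ∀ v : HeightOneSpectrum (𝓞 K),
      ((q : ℕ) : 𝓞 K) ∈ v.asIdeal → κ₀ m n ∈ toricLocalKer (W.baseChange K) (v.adicCompletion K) ((p ^ 1 : ℕ) : ℤ))
    (transverse_on : ∀ n : Finset (AdmQ W K p), n.Nonempty → Even n.card →
      ∀ m : Finset {ℓ // Zhang2014.IsKolyvaginPrime (W.conductorNorm ℤ) W K p ℓ}, ∀ ℓ ∈ m,
      ∀ v : HeightOneSpectrum (𝓞 K),
      ((ℓ : ℕ) : 𝓞 K) ∈ v.asIdeal → κ₀ m n ∈ transverseLocalKerP W K p ι ℓ v)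
    (relation : ∀ n : Finset (AdmQ W K p), n.Nonempty → Even n.card →
      ∀ (m : Finset {ℓ // Zhang2014.IsKolyvaginPrime (W.conductorNorm ℤ) W K p ℓ})
        (ℓ : {ℓ // Zhang2014.IsKolyvaginPrime (W.conductorNorm ℤ) W K p ℓ}), ℓ ∉ m → ∀ v : HeightOneSpectrum (𝓞 K),
      ((ℓ : ℕ) : 𝓞 K) ∈ v.asIdeal →
      (κ₀ (insert ℓ m) n ∈ (W.baseChange K).torsionLocalKer (v.adicCompletion K) ((p ^ 1 : ℕ) : ℤ) ↔
        κ₀ m n ∈ (W.baseChange K).torsionLocalKer (v.adicCompletion K) ((p ^ 1 : ℕ) : ℤ)))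
    (lawA : ∀ (n : Finset (AdmQ W K p)) (q : AdmQ W K p), Even n.card → q ∉ n →
      ∀ m : Finset {ℓ // Zhang2014.IsKolyvaginPrime (W.conductorNorm ℤ) W K p ℓ},
      lam m (insert q n) ≠ 0 ↔ ∃ v : HeightOneSpectrum (𝓞 K), ((q : ℕ) : 𝓞 K) ∈ v.asIdeal ∧
        κ₀ m n ∉ (W.baseChange K).torsionLocalKer (v.adicCompletion K) ((p ^ 1 : ℕ) : ℤ))
    (lawB : ∀ (n : Finset (AdmQ W K p)) (q : AdmQ W K p), Odd n.card → q ∉ n →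
      ∀ m : Finset {ℓ // Zhang2014.IsKolyvaginPrime (W.conductorNorm ℤ) W K p ℓ},
      (∃ v : HeightOneSpectrum (𝓞 K), ((q : ℕ) : 𝓞 K) ∈ v.asIdeal ∧
        κ₀ m (insert q n) ∉ (W.baseChange K).torsionLocalKer (v.adicCompletion K) ((p ^ 1 : ℕ) : ℤ)) ↔ lam m n ≠ 0)
    (selmer_bottom : ∃ μ : Bool, κ₀ ∅ ∅ ∈ SelQP W K p c ∅ μ)
    (n₀ : Finset (AdmQ W K p))
    (hcore₀ : finrank (ZMod p) (SelQP W K p c n₀ true) + finrank (ZMod p) (SelQP W K p c n₀ false) ≤ 1)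
    (seed : (Even n₀.card ∧ κ₀ ∅ n₀ ≠ 0) ∨ (Odd n₀.card ∧ lam ∅ n₀ ≠ 0))
    (hPT : poitouTate_selmerStructure_duality K)
    (hodd : Odd (finrank (ZMod p) (SelQP W K p c ∅ true) + finrank (ZMod p) (SelQP W K p c ∅ false))) :
    Nonempty (LevelKolyvaginSystemP W K p Dt β ι c) :=
  nonempty_levelKolyvaginSystemP_of_bipartite_of_seed_at_frame W K p c Dt β ι h5 hadd hsurj hK hH hc1 ε₀ κ₀ lam realisation
    sign selmer_off selmer_inf toric_on transverse_on relation lawA lawB selmer_bottom n₀ hcore₀ seed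
    (selQP_raise_free W K p hK (by omega) c hPT) hodd

end Summit.BirchSwinnertonDyer.BirchSwinnertonDyer.Theorems.AdditiveKoly

end
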